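import Summits.QuantumFields.BalabanUV.T4Continuum.Support.VariationalColourTaxiTowerStep
import Summits.QuantumFields.BalabanUV.T4Continuum.Support.VariationalVectorGaugeSlice

/-!
# T⁴ programme, spine node NE2 (U1a), lane P2 — «COMP-FIBRE-RELABEL»: THE COMPOSITE GAUGE-FIXING KERNEL AND BAŁABAN's PROJECTED FUNCTIONAL READ THROUGH THE BLOCK NESTING
# `sites` — STEP (i) of the composite-fibre ↔ taxi-frame bridge (model level; cell `pub-balaban`)

NE2 formalisation swarm `b2b-balaban-t4-ne2-formalise-*`, leaf prover 03 GEN 7 (`prover-b2b-balaban-t4-ne2-formalise-leaf-03-g7-0`); register row «P2-sup» of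
`t4/formal/NE2/LEAVES.md`; journal INTENT «COMP-FIBRE-RELABEL» CLAIMS.log l.21035 (2026-08-20 20:33Z) = STEP (i) of leaf-04-g6's published successor plan
`HOME/t4/b2b-balaban-t4-ne2-formalise-leaf-04/g6/NEXT-composite-fibre-bridge.md`.  On top of leaf-02-g4's `VariationalColourTower.{Rtrv, compTv, Qcv_comp_Qcv_apply, sites_add}`,
leaf-09-g7's `VariationalVectorGaugeSlice.{avgOp, lapOp, sliceSub, projG}` and the tree's `B5Composition116.sites` BY NAME; Mathlib's `LinearEquiv.funCongrLeft`,
`LinearIsometryEquiv.piLpCongrLeft`, `Submodule.starProjection_map_apply`.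

THE POINT.  leaf-01-g8∕g9's (ONE-min) supplier (`VariationalVectorOneMinCentred.hONEm_centred`, `…CentredReg.hONEm_centred_reg`) gauge-fixes the FINE level with the COMPOSITE
kernel `K_comp := ker ((avgOp n M T).comp (avgOp L (fine n M) T′))` on the two-level torus `Tor (fine L (fine n M))`, while the vector END at taxi data (`VariationalColourTaxiTowerProjG*`,
parts 6–8, and the orbit form `VariationalColourTaxiTowerProjGOrbit`) uses `G′ k := fun W′ => projG (fine (L^(k+1)) M) (Rlev (k+1)) K (W′ ∘ sites (L^k) L M)` on the composite torus
`Tor (fine (L^k·L) M)`.  This file is the RELABELLING between the two presentations: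
 * §1 the TRANSPORT LAWS along `sites` (`sites` additive ∕ subtractive — `VariationalCovariantTower.sites_add`, `VariationalVectorLandauTower.sites_sub`): `cDv_transport`, `DirAdjv_transport`, **`divV_transport`** (`divV (fine (n·L) M) (Rtrv R′) (W′ ∘ sites) x = divV (fine L (fine n M)) R′ W′ (sites x)`),
   `lapOp_transport` (the pattern of `VariationalColourTower.dirUv_transport`, one operator up);
 * §2 **`sliceSub_transport`** (`S_{Rtrv R′}(K′ ∘ sites) = (S_{R′} K′) ∘ sites` as `Submodule.map` along Mathlib's `funCongrLeft` ∕ `piLpCongrLeft`) and **`projG_transport`**: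
   `projG (fine (n·L) M) (Rtrv n L M R′) (K′.map (funCongrLeft ℂ E sites)) (W′ ∘ sites) = projG (fine L (fine n M)) R′ K′ W′` (orthogonal projections commute with the isometry);
 * §3 **`ker_compTv_eq`**: `ker (avgOp (n·L) M (compTv n L M T T′)) = (ker ((avgOp n M T).comp (avgOp L (fine n M) T′))).map (funCongrLeft ℂ E sites)` — the composite frames' kernel IS
   `K_comp` read on the composite torus (`Qcv_comp_Qcv_apply` BY NAME);
 * §5 for STEP (ii): **`norm_twoStepTaxi_sub_taxiTv_le`** — the two-step taxi frames are `d²·L(L^k−1)(L−1)·b_k`-close to the straight taxi of the composite torus (gen 4's merge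
   `outer_mul_inner_sub_mergedAcc_le` ∕ `mergedAcc_eq_taxiAcc` read at a point; `O(d²c∕L^k)`, DECAYING);
 * §4 THE CONSUMER IDENTITY **`projG_compFibre_eq`**: `projG (fine L (fine n M)) R′ K_comp W′ = projG (fine (n·L) M) (Rtrv n L M R′) (ker (avgOp (n·L) M (compTv n L M T T′))) (W′ ∘ sites n L M)`
   — leaf-01's `G′` IS the END's `G′ k`-shape for the COMPOSITE frames `compTv T T′`; at the END's data (`T = taxiTv (L^k) M (Rlev k)` straight, `T′ = taxiTv L _ (R′ k)` one-step) this is the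
   TWO-STEP taxi (**`projG_taxiTwoStep_eq`**); `projG_nestTv_eq` records the all-levels nested instance.  What STEP (ii) of the bridge must still do: move the two-step taxi frames to the
   straight `taxiTv (L^(k+1)) M (Rlev (k+1))` (gen 4's merge `outer_mul_inner_sub_mergedAcc_le` ∕ `mergedAcc_eq_taxiAcc`, distance `O(d²c∕L^k)`, DECAYING; then leaf-04-g6's
   `SliceFrameGap.sliceFrames_close`, in the coefficient-one form `DivControlOfSliceClose.norm_starProjection_le_of_oneSided'`) and the one-step carriers `frameT ↔ lineT ∘ taxiTv` — NOT done here.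

HONEST FRAMING (T4-DAG p. 1).  Model level (c5: operators ∕ frames DATA; no B0); [folklore] relabelling algebra, NO analytic content; no `def`, no `def … : Prop`, no `sorry`; axioms
standard.  (ONE-min) ∕ V-END with background NOT proved; NE2 NOT proved on either road; NE3 OPEN; spine PROVED 0∕9 unchanged; rung (B)+1 on a fixed finite T⁴ — NOT infinite volume,
NOT mass gap, NOT Clay.  HONEST DEPENDENCY (cell, verbatim): continuum YM on T⁴ ⇐ BetaPertH ∧ nine spine estimates (0/9 proved); BetaPertH ⇐ (D1) ∧ (D4) ∧ CAP+tail; G-an2-4 gates asym,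
D1 and NE2/3/4.
-/

noncomputable section

namespace Summit.QuantumFields.BalabanUV.T4Continuum.CompositeFibreRelabel

open Finset WithLp
open scoped BigOperators
open Literature.MathematicalPhysics.QuantumFieldTheory.Balaban1983to89.B5Prop11Plancherel (Tor fine unitVec)
open Literature.MathematicalPhysics.QuantumFieldTheory.Balaban1983to89.B5Composition116 (sites J JEquiv JEquiv_apply bpt_bpt)
open Summit.QuantumFields.BalabanUV.T4Continuum.VariationalColourFederbush (cDv Qcv)
open Summit.QuantumFields.BalabanUV.T4Continuum.VariationalColourBochner (DirAdjv)
open Summit.QuantumFields.BalabanUV.T4Continuum.VariationalColourTower (Rtrv compTv Qcv_comp_Qcv_apply)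
open Summit.QuantumFields.BalabanUV.T4Continuum.VariationalCovariantTower (sites_add)
open Summit.QuantumFields.BalabanUV.T4Continuum.VariationalTower (sites_unitVec)
open Summit.QuantumFields.BalabanUV.T4Continuum.VariationalColourTaxiTransport
  (taxiTv taxiTv_bpt coarseTv nestTv nestLv Rlev coarseTv_eq_Rlev mergedAcc mergedAcc_eq_taxiAcc outer_mul_inner_sub_mergedAcc_le)
open Literature.MathematicalPhysics.QuantumFieldTheory.Balaban1983to89.B5Block118 (bpt)
open Literature.MathematicalPhysics.QuantumFieldTheory.Balaban1983to89.B5Blocks16 (blockOf blockOf_bpt bpt_bijective)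
open Summit.QuantumFields.BalabanUV.T4Continuum.VariationalVectorWeitzenbock (divV divV_apply)
open Summit.QuantumFields.BalabanUV.T4Continuum.VariationalVectorGaugeSlice (avgOp avgOp_apply lapOp lapOp_apply sliceSub mem_sliceSub projG)

variable {d : ℕ} {E : Type*} [NormedAddCommGroup E] [InnerProductSpace ℂ E] [CompleteSpace E]
variable (n L : ℕ) [NeZero n] [NeZero L] (M : Fin d → ℕ) [hM : ∀ μ, NeZero (M μ)]

/-! ## §1 Transport of the covariant differences, the divergence and the Laplacian along `sites` -/

omit [CompleteSpace E] [NeZero n] [NeZero L] hM in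
/-- the covariant difference is transported: `cDv (Rtrv R′) (f′ ∘ sites) x μ = cDv R′ f′ (sites x) μ`. [folklore] -/
theorem cDv_transport (R' : Tor (fine L (fine n M)) → Fin d → (E →L[ℂ] E)) (f' : Tor (fine L (fine n M)) → E) (x : Tor (fine (n * L) M)) (μ : Fin d) :
    cDv (fine (n * L) M) (Rtrv n L M R') (f' ∘ sites n L M) x μ = cDv (fine L (fine n M)) R' f' (sites n L M x) μ := by
  simp only [cDv, Rtrv, Function.comp_apply, sites_add, sites_unitVec]

omit [NeZero n] [NeZero L] hM in
/-- the adjoint difference is transported: `DirAdjv (Rtrv R′) μ (g′ ∘ sites) x = DirAdjv R′ μ g′ (sites x)`. [folklore] -/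
theorem DirAdjv_transport (R' : Tor (fine L (fine n M)) → Fin d → (E →L[ℂ] E)) (μ : Fin d) (g' : Tor (fine L (fine n M)) → E) (x : Tor (fine (n * L) M)) :
    DirAdjv (fine (n * L) M) (Rtrv n L M R') μ (g' ∘ sites n L M) x = DirAdjv (fine L (fine n M)) R' μ g' (sites n L M x) := by
  -- `sites` is subtractive (as `VariationalVectorLandauTower.sites_sub`, re-derived inline to keep the import cone small)
  have hsub : ∀ a b : Tor (fine (n * L) M), sites n L M (a - b) = sites n L M a - sites n L M b :=
    fun a b => eq_sub_of_add_eq (by rw [← sites_add, sub_add_cancel])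
  simp only [DirAdjv, Rtrv, Function.comp_apply, hsub, sites_unitVec]

omit [NeZero n] [NeZero L] hM in
/-- **the covariant divergence is transported**: `divV (Rtrv R′) (W′ ∘ sites) x = divV R′ W′ (sites x)`. [folklore] -/
theorem divV_transport (R' : Tor (fine L (fine n M)) → Fin d → (E →L[ℂ] E)) (W' : Tor (fine L (fine n M)) → Fin d → E) (x : Tor (fine (n * L) M)) :
    divV (fine (n * L) M) (Rtrv n L M R') (fun x => W' (sites n L M x)) x = divV (fine L (fine n M)) R' W' (sites n L M x) := by
  rw [divV_apply, divV_apply]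
  have hsub : ∀ a b : Tor (fine (n * L) M), sites n L M (a - b) = sites n L M a - sites n L M b :=
    fun a b => eq_sub_of_add_eq (by rw [← sites_add, sub_add_cancel])
  refine sum_congr rfl fun μ _ => ?_
  simp only [Rtrv, hsub, sites_unitVec]

omit [NeZero n] [NeZero L] hM in
/-- the same as an identity of functions. [folklore] -/
theorem divV_transport' (R' : Tor (fine L (fine n M)) → Fin d → (E →L[ℂ] E)) (W' : Tor (fine L (fine n M)) → Fin d → E) :
    divV (fine (n * L) M) (Rtrv n L M R') (fun x => W' (sites n L M x)) = divV (fine L (fine n M)) R' W' ∘ sites n L M :=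
  funext (divV_transport n L M R' W')

omit [NeZero n] [NeZero L] hM in
/-- **the covariant Laplacian is transported**: `lapOp (Rtrv R′) (f′ ∘ sites) = (lapOp R′ f′) ∘ sites`. [folklore] -/
theorem lapOp_transport (R' : Tor (fine L (fine n M)) → Fin d → (E →L[ℂ] E)) (f' : Tor (fine L (fine n M)) → E) :
    lapOp (fine (n * L) M) (Rtrv n L M R') (f' ∘ sites n L M) = lapOp (fine L (fine n M)) R' f' ∘ sites n L M := by
  rw [lapOp_apply, lapOp_apply]
  have h : cDv (fine (n * L) M) (Rtrv n L M R') (f' ∘ sites n L M) = fun x μ => cDv (fine L (fine n M)) R' f' (sites n L M x) μ :=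
    funext fun x => funext fun μ => cDv_transport n L M R' f' x μ
  rw [h]
  exact divV_transport' n L M R' _

/-! ## §2 The slice subspace and the projected functional, relabelled -/

/-- **THE SLICE SUBSPACE IS TRANSPORTED**: `S_{Rtrv R′}(K′.map (· ∘ sites)) = (S_{R′} K′).map ((piLpCongrLeft sites)⁻¹)`. [folklore] -/
theorem sliceSub_transport (R' : Tor (fine L (fine n M)) → Fin d → (E →L[ℂ] E)) (K' : Submodule ℂ (Tor (fine L (fine n M)) → E)) :
    sliceSub (fine (n * L) M) (Rtrv n L M R') (K'.map (LinearEquiv.funCongrLeft ℂ E (sites n L M) : _ →ₗ[ℂ] _))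
      = (sliceSub (fine L (fine n M)) R' K').map
          ((LinearIsometryEquiv.piLpCongrLeft 2 ℂ E (sites n L M)).symm.toLinearEquiv : _ →ₗ[ℂ] _) := by
  ext v
  rw [Submodule.mem_map_equiv, mem_sliceSub, mem_sliceSub, Submodule.mem_map, Submodule.mem_map]
  -- the relabelled `ℓ²` vector, unfolded
  have esymm : ofLp ((LinearIsometryEquiv.piLpCongrLeft 2 ℂ E (sites n L M)).symm.toLinearEquiv.symm v) = ofLp v ∘ (sites n L M).symm := by
    funext z
    simp [LinearIsometryEquiv.piLpCongrLeft_apply]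
  rw [esymm]
  constructor
  · rintro ⟨g, hg, hgv⟩
    rw [Submodule.mem_map] at hg
    obtain ⟨f', hf', rfl⟩ := hg
    refine ⟨f', hf', ?_⟩
    have h2 : lapOp (fine (n * L) M) (Rtrv n L M R') (f' ∘ sites n L M) = ofLp v := hgv
    rw [lapOp_transport] at h2
    funext z
    have := congrFun h2 ((sites n L M).symm z)
    simpa using this
  · rintro ⟨f', hf', hfv⟩
    refine ⟨f' ∘ sites n L M, Submodule.mem_map_of_mem hf', ?_⟩
    show lapOp (fine (n * L) M) (Rtrv n L M R') (f' ∘ sites n L M) = ofLp v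
    rw [lapOp_transport, hfv]
    funext x
    simp

/-- the transported divergence read in `ℓ²`: `toLp (div_{Rtrv R′}(W′ ∘ sites)) = (piLpCongrLeft sites)⁻¹ (toLp (div_{R′} W′))`. [folklore] -/
theorem toLp_divV_transport (R' : Tor (fine L (fine n M)) → Fin d → (E →L[ℂ] E)) (W' : Tor (fine L (fine n M)) → Fin d → E) :
    toLp 2 (divV (fine (n * L) M) (Rtrv n L M R') (fun x => W' (sites n L M x)))
      = (LinearIsometryEquiv.piLpCongrLeft 2 ℂ E (sites n L M)).symm (toLp 2 (divV (fine L (fine n M)) R' W')) := by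
  apply (LinearIsometryEquiv.piLpCongrLeft 2 ℂ E (sites n L M)).injective
  rw [LinearIsometryEquiv.apply_symm_apply, divV_transport']
  ext z
  simp [LinearIsometryEquiv.piLpCongrLeft_apply]

variable [FiniteDimensional ℂ E]

/-- **BAŁABAN's PROJECTED FUNCTIONAL IS TRANSPORTED**: `projG (Rtrv R′) (K′.map (· ∘ sites)) (W′ ∘ sites) = projG R′ K′ W′`. [folklore] -/
theorem projG_transport (R' : Tor (fine L (fine n M)) → Fin d → (E →L[ℂ] E)) (K' : Submodule ℂ (Tor (fine L (fine n M)) → E))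
    (W' : Tor (fine L (fine n M)) → Fin d → E) :
    projG (fine (n * L) M) (Rtrv n L M R') (K'.map (LinearEquiv.funCongrLeft ℂ E (sites n L M) : _ →ₗ[ℂ] _)) (fun x => W' (sites n L M x))
      = projG (fine L (fine n M)) R' K' W' := by
  have key : ∀ (S : Submodule ℂ (PiLp 2 (fun _ : Tor (fine L (fine n M)) => E))) (S' : Submodule ℂ (PiLp 2 (fun _ : Tor (fine (n * L) M) => E)))
      (_ : S' = S.map ((LinearIsometryEquiv.piLpCongrLeft 2 ℂ E (sites n L M)).symm.toLinearEquiv : _ →ₗ[ℂ] _)) (y : PiLp 2 (fun _ : Tor (fine L (fine n M)) => E)),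
      ‖S'.starProjection ((LinearIsometryEquiv.piLpCongrLeft 2 ℂ E (sites n L M)).symm y)‖ = ‖S.starProjection y‖ := by
    rintro S S' rfl y
    rw [Submodule.starProjection_map_apply, LinearIsometryEquiv.symm_apply_apply, LinearIsometryEquiv.norm_map]
  unfold projG
  rw [toLp_divV_transport, key _ _ (sliceSub_transport n L M R' K')]

/-! ## §3 The composite frames' kernel is `K_comp` read on the composite torus -/

omit [CompleteSpace E] [FiniteDimensional ℂ E] in
/-- **`ker Q_{compTv T T′} = K_comp ∘ sites`**: `ker (avgOp (n·L) M (compTv n L M T T′)) = (ker ((avgOp n M T).comp (avgOp L (fine n M) T′))).map (· ∘ sites)`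
(leaf-02-g4's COMP⁺ `Qcv_comp_Qcv_apply`). [folklore] -/
theorem ker_compTv_eq (T : Tor (fine n M) → (E →L[ℂ] E)) (T' : Tor (fine L (fine n M)) → (E →L[ℂ] E)) :
    LinearMap.ker (avgOp (n * L) M (compTv n L M T T'))
      = (LinearMap.ker ((avgOp n M T).comp (avgOp L (fine n M) T'))).map (LinearEquiv.funCongrLeft ℂ E (sites n L M) : _ →ₗ[ℂ] _) := by
  ext g
  rw [Submodule.mem_map_equiv, LinearMap.mem_ker, LinearMap.mem_ker, LinearMap.comp_apply, avgOp_apply, avgOp_apply, avgOp_apply]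
  have hg : g = (fun z => g ((sites n L M).symm z)) ∘ sites n L M := by funext x; simp
  have h := Qcv_comp_Qcv_apply n L M T T' (fun z => g ((sites n L M).symm z))
  rw [Function.comp_apply, ← hg] at h
  rw [← h]
  rfl

/-! ## §4 The consumer identity -/

/-- **leaf-01's `G′` IS the END's `G′`-shape for the composite frames**:
`projG (fine L (fine n M)) R′ K_comp W′ = projG (fine (n·L) M) (Rtrv n L M R′) (ker Q_{compTv T T′}) (W′ ∘ sites)`. [folklore] -/
theorem projG_compFibre_eq (R' : Tor (fine L (fine n M)) → Fin d → (E →L[ℂ] E)) (T : Tor (fine n M) → (E →L[ℂ] E)) (T' : Tor (fine L (fine n M)) → (E →L[ℂ] E))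
    (W' : Tor (fine L (fine n M)) → Fin d → E) :
    projG (fine L (fine n M)) R' (LinearMap.ker ((avgOp n M T).comp (avgOp L (fine n M) T'))) W'
      = projG (fine (n * L) M) (Rtrv n L M R') (LinearMap.ker (avgOp (n * L) M (compTv n L M T T'))) (fun x => W' (sites n L M x)) := by
  rw [ker_compTv_eq, projG_transport]

/-- **ALONG THE TAXI TOWER — THE END's INSTANCE**: the vector END at taxi data gauge-fixes level `k` with the STRAIGHT taxi frames `taxiTv (L^k) M (Rlev k)` (parts 6–8); with the
one-step taxi frames `taxiTv L _ (R′ k)` at the fine level, leaf-01's composite kernel is the kernel of the TWO-STEP taxi frames `compTv (taxiTv (Rlev k)) (taxiTv (R′ k))` on the composite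
torus, and its fine functional IS `W′ ↦ projG (fine (L^(k+1)) M) (Rlev (k+1)) (ker Q_{two-step taxi}) (W′ ∘ sites)` (`Rlev (k+1) = Rtrv (R′ k)`, rfl).  STEP (ii) of the bridge then moves
the two-step taxi to the straight level-`k+1` taxi `taxiTv (L^(k+1)) M (Rlev (k+1))` — gen 4's merge `VariationalColourTaxiTowerMerge.outer_mul_inner_sub_mergedAcc_le` +
`VariationalColourTaxiTowerStep.mergedAcc_eq_taxiAcc` (distance `≤ d²·L(L^k−1)(L−1)·b_k = O(d²c∕L^k)`, DECAYING) fed to leaf-04-g6's `SliceFrameGap.sliceFrames_close`. [folklore] -/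
theorem projG_taxiTwoStep_eq (R' : (k : ℕ) → Tor (fine L (fine (L ^ k) M)) → Fin d → (E →L[ℂ] E)) (k : ℕ) (W' : Tor (fine L (fine (L ^ k) M)) → Fin d → E) :
    projG (fine L (fine (L ^ k) M)) (R' k)
        (LinearMap.ker ((avgOp (L ^ k) M (taxiTv (L ^ k) M (Rlev L M R' k))).comp (avgOp L (fine (L ^ k) M) (taxiTv L (fine (L ^ k) M) (R' k))))) W'
      = projG (fine (L ^ (k + 1)) M) (Rlev L M R' (k + 1))
          (LinearMap.ker (avgOp (L ^ (k + 1)) M (compTv (L ^ k) L M (taxiTv (L ^ k) M (Rlev L M R' k)) (taxiTv L (fine (L ^ k) M) (R' k)))))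
          (fun x => W' (sites (L ^ k) L M x)) :=
  projG_compFibre_eq (L ^ k) L M (R' k) (taxiTv (L ^ k) M (Rlev L M R' k)) (taxiTv L (fine (L ^ k) M) (R' k)) W'

/-- the same relabelling for the NESTED frames of ALL levels (`nestTv (k+1) = compTv (nestTv k) (taxiTv (R′ k))`, `VariationalColourTaxiTower.nestTv_succ`, rfl) — recorded for COMP⁺; NOT the
END's reference kernel (the nested frames' in-block mismatch is not `O(1∕n)` k-uniformly, which is why parts 6–8 gauge-fix with the straight taxi). [folklore] -/
theorem projG_nestTv_eq (R' : (k : ℕ) → Tor (fine L (fine (L ^ k) M)) → Fin d → (E →L[ℂ] E)) (k : ℕ) (W' : Tor (fine L (fine (L ^ k) M)) → Fin d → E) :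
    projG (fine L (fine (L ^ k) M)) (R' k) (LinearMap.ker ((avgOp (L ^ k) M (nestTv L M R' k)).comp (avgOp L (fine (L ^ k) M) (taxiTv L (fine (L ^ k) M) (R' k))))) W'
      = projG (fine (L ^ (k + 1)) M) (Rlev L M R' (k + 1)) (LinearMap.ker (avgOp (L ^ (k + 1)) M (nestTv L M R' (k + 1)))) (fun x => W' (sites (L ^ k) L M x)) :=
  projG_compFibre_eq (L ^ k) L M (R' k) (nestTv L M R' k) (taxiTv L (fine (L ^ k) M) (R' k)) W'

/-! ## §5 For STEP (ii): the two-step taxi IS the straight taxi of the composite torus up to a DECAYING defect -/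

omit [CompleteSpace E] [FiniteDimensional ℂ E] in
/-- **THE TWO-STEP TAXI AGAINST THE STRAIGHT TAXI** (gen 4's merge, read at a point): along a coherent tower with contractive one-step bonds of plaquette defect `≤ b k`,
`‖compTv (taxiTv (Rlev k)) (taxiTv (R′ k)) x − taxiTv (L^k·L) M (Rlev (k+1)) x‖ ≤ d·d·(L(L^k − 1)(L − 1)·b k)` — `O(d²c∕L^k)` under `(L^{k+1})²b_k ≤ c`, i.e. DECAYING: the frame
distance that `SliceFrameGap.sliceFrames_close` consumes in STEP (ii). [folklore] -/
theorem norm_twoStepTaxi_sub_taxiTv_le {R' : (k : ℕ) → Tor (fine L (fine (L ^ k) M)) → Fin d → (E →L[ℂ] E)} (hR' : ∀ k x μ, ‖R' k x μ‖ ≤ 1) {b : ℕ → ℝ}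
    (hb : ∀ k x κ ι, ‖R' k x κ * R' k (x + unitVec (fine L (fine (L ^ k) M)) κ) ι - R' k x ι * R' k (x + unitVec (fine L (fine (L ^ k) M)) ι) κ‖ ≤ b k)
    (hcoh : ∀ k, coarseTv L (fine (L ^ (k + 1)) M) (R' (k + 1)) = Rtrv (L ^ k) L M (R' k)) (k : ℕ) (x : Tor (fine (L ^ k * L) M)) :
    ‖compTv (L ^ k) L M (taxiTv (L ^ k) M (Rlev L M R' k)) (taxiTv L (fine (L ^ k) M) (R' k)) x - taxiTv (L ^ k * L) M (Rlev L M R' (k + 1)) x‖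
      ≤ (d : ℝ) * ((d : ℝ) * (((L : ℝ) * ((L ^ k - 1 : ℕ) : ℝ) * ((L - 1 : ℕ) : ℝ)) * b k)) := by
  obtain ⟨⟨y, Jx⟩, rfl⟩ := (bpt_bijective (L ^ k * L) M).2 x
  obtain ⟨⟨j₂, j₁⟩, rfl⟩ := (JEquiv (L ^ k) L).surjective Jx
  rw [JEquiv_apply]
  show ‖taxiTv (L ^ k) M (Rlev L M R' k) (blockOf L (fine (L ^ k) M) (sites (L ^ k) L M (bpt (L ^ k * L) M y (J (L ^ k) L j₂ j₁))))
      * taxiTv L (fine (L ^ k) M) (R' k) (sites (L ^ k) L M (bpt (L ^ k * L) M y (J (L ^ k) L j₂ j₁)))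
      - taxiTv (L ^ k * L) M (Rtrv (L ^ k) L M (R' k)) (bpt (L ^ k * L) M y (J (L ^ k) L j₂ j₁))‖ ≤ _
  rw [← bpt_bpt, blockOf_bpt, taxiTv_bpt, taxiTv_bpt, taxiTv_bpt, ← coarseTv_eq_Rlev L M R' hcoh k, ← mergedAcc_eq_taxiAcc]
  exact outer_mul_inner_sub_mergedAcc_le L (L ^ k) M (hR' k) (hb k) y j₂ j₁

end Summit.QuantumFields.BalabanUV.T4Continuum.CompositeFibreRelabel

end
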